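import Mathlib
import HarnessLib

/-!
# Half-line damped trigonometric integrals (helper file for stub TORUS-SEP)

Route `WeilParity`, crux `OffLineParityDetection` (item stmt-RiemannHypothesis-15431), line
`registered`, stub `stub_torusTopHeavySeparated` (TORUS-SEP).  Pure real analysis, no zeta facts
and no definitions.

For `η > 0`, a phase point `a` and a frequency `ω` put `D = 4η² + ω²` and
`h_a(ω) = ∫₀^∞ e^{-2ηu} cos(ω(u-a)) du`, `q_a(ω) = ∫₀^∞ e^{-2ηu} sin(ω(u-a)) du`.
These are the building blocks of the Gram matrices of the families
`e^{-ηu} cos(γ(u-a))`, `e^{-ηu} sin(γ(u-a))` on `L²(0, ∞)`.  This file provides: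

* the closed forms `h_a(ω) = (2η cos(ωa) + ω sin(ωa))/D`, `q_a(ω) = (ω cos(ωa) - 2η sin(ωa))/D`
  (explicit antiderivatives + FTC on `(0, ∞)`), and the window decomposition
  `h_a(ω) = ∫₀^a e^{-2ηu} cos(ω(u-a)) du + 2η e^{-2ηa}/D`;
* the size bounds `h² + q² = 1/D`, `|h|, |q| ≤ 1/|ω|`;
* the SIGN STRUCTURE in the quarter window `0 ≤ ωa ≤ π/2`, `a ≥ 0`: `h_a(ω) ≥ (2a/π) ω²/D ≥ 0`
  (Jordan's inequality) and `h_a` is non-increasing in `ω` on `[0, π/(2a)]` (cosine is decreasing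
  on `[0, π]`, `2η/D` is decreasing).

Everything is folklore calculus and fully proved.
-/

set_option linter.dupNamespace false

noncomputable section

namespace Summit.RiemannHypothesis.RiemannHypothesis.Theorems.WeilParityOffLineParityDetection

open MeasureTheory Set Filter intervalIntegral
open scoped Topology

/-! ## Antiderivatives -/

/-- `d/du (ω(u-a)) = ω`. [folklore] -/
theorem torusSep_hasDerivAt_lin (ω a u : ℝ) : HasDerivAt (fun x : ℝ ↦ ω * (x - a)) ω u := by
  simpa using ((hasDerivAt_id u).sub_const a).const_mul ω

/-- `d/du e^{-2ηu} = -2η e^{-2ηu}`. [folklore] -/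
theorem torusSep_hasDerivAt_exp (η u : ℝ) :
    HasDerivAt (fun x : ℝ ↦ Real.exp (-(2 * η * x))) (Real.exp (-(2 * η * u)) * (-(2 * η))) u := by
  have h : HasDerivAt (fun x : ℝ ↦ -(2 * η * x)) (-(2 * η)) u := by
    simpa [neg_mul] using (hasDerivAt_id u).const_mul (-(2 * η))
  exact h.exp

/-- Antiderivative of `e^{-2ηu} cos(ω(u-a))`:
`e^{-2ηu} (-2η cos(ω(u-a)) + ω sin(ω(u-a)))/(4η²+ω²)`. [folklore] -/
theorem torusSep_hasDerivAt_cos {η ω : ℝ} (hD : 4 * η ^ 2 + ω ^ 2 ≠ 0) (a u : ℝ) :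
    HasDerivAt (fun x : ℝ ↦ Real.exp (-(2 * η * x)) *
        (-(2 * η) * Real.cos (ω * (x - a)) + ω * Real.sin (ω * (x - a))) / (4 * η ^ 2 + ω ^ 2))
      (Real.exp (-(2 * η * u)) * Real.cos (ω * (u - a))) u := by
  have h1 := ((torusSep_hasDerivAt_lin ω a u).cos.const_mul (-(2 * η))).fun_add
    ((torusSep_hasDerivAt_lin ω a u).sin.const_mul ω)
  refine (((torusSep_hasDerivAt_exp η u).fun_mul h1).div_const (4 * η ^ 2 + ω ^ 2)).congr_deriv ?_
  rw [div_eq_iff hD]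
  ring

/-- Antiderivative of `e^{-2ηu} sin(ω(u-a))`:
`e^{-2ηu} (-2η sin(ω(u-a)) - ω cos(ω(u-a)))/(4η²+ω²)`. [folklore] -/
theorem torusSep_hasDerivAt_sin {η ω : ℝ} (hD : 4 * η ^ 2 + ω ^ 2 ≠ 0) (a u : ℝ) :
    HasDerivAt (fun x : ℝ ↦ Real.exp (-(2 * η * x)) *
        (-(2 * η) * Real.sin (ω * (x - a)) - ω * Real.cos (ω * (x - a))) / (4 * η ^ 2 + ω ^ 2))
      (Real.exp (-(2 * η * u)) * Real.sin (ω * (u - a))) u := by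
  have h1 := ((torusSep_hasDerivAt_lin ω a u).sin.const_mul (-(2 * η))).fun_sub
    ((torusSep_hasDerivAt_lin ω a u).cos.const_mul ω)
  refine (((torusSep_hasDerivAt_exp η u).fun_mul h1).div_const (4 * η ^ 2 + ω ^ 2)).congr_deriv ?_
  rw [div_eq_iff hD]
  ring

/-! ## Integrability and decay -/

/-- `e^{-2ηu} · (bounded continuous)` is integrable on `(c, ∞)` for `η > 0`. [folklore] -/
theorem torusSep_integrableOn_exp_mul {η : ℝ} (hη : 0 < η) {k : ℝ → ℝ} (hk : Continuous k)
    (hk1 : ∀ u, |k u| ≤ 1) (c : ℝ) :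
    IntegrableOn (fun u : ℝ ↦ Real.exp (-(2 * η * u)) * k u) (Ioi c) := by
  have hg : IntegrableOn (fun u : ℝ ↦ Real.exp (-(2 * η * u))) (Ioi c) := by
    have := exp_neg_integrableOn_Ioi c (by positivity : 0 < 2 * η)
    refine this.congr_fun (fun u _ ↦ ?_) measurableSet_Ioi
    ring_nf
  refine Integrable.mono' hg (by fun_prop) (ae_of_all _ fun u ↦ ?_)
  rw [Real.norm_eq_abs, abs_mul, abs_of_pos (Real.exp_pos _)]
  calc Real.exp (-(2 * η * u)) * |k u| ≤ Real.exp (-(2 * η * u)) * 1 :=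
        mul_le_mul_of_nonneg_left (hk1 u) (Real.exp_pos _).le
    _ = Real.exp (-(2 * η * u)) := mul_one _

/-- `e^{-2ηu} cos(ω(u-a))` is integrable on `(c, ∞)` for `η > 0`. [folklore] -/
theorem torusSep_integrableOn_exp_cos {η : ℝ} (hη : 0 < η) (ω a c : ℝ) :
    IntegrableOn (fun u : ℝ ↦ Real.exp (-(2 * η * u)) * Real.cos (ω * (u - a))) (Ioi c) :=
  torusSep_integrableOn_exp_mul hη (by fun_prop) (fun u ↦ Real.abs_cos_le_one _) c

/-- `e^{-2ηu} sin(ω(u-a))` is integrable on `(c, ∞)` for `η > 0`. [folklore] -/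
theorem torusSep_integrableOn_exp_sin {η : ℝ} (hη : 0 < η) (ω a c : ℝ) :
    IntegrableOn (fun u : ℝ ↦ Real.exp (-(2 * η * u)) * Real.sin (ω * (u - a))) (Ioi c) :=
  torusSep_integrableOn_exp_mul hη (by fun_prop) (fun u ↦ Real.abs_sin_le_one _) c

/-- `e^{-2ηu} · (bounded) / D → 0` as `u → ∞` (`η > 0`). [folklore] -/
theorem torusSep_tendsto_exp_mul_zero {η : ℝ} (hη : 0 < η) {k : ℝ → ℝ} {B : ℝ}
    (hk : ∀ u, |k u| ≤ B) (D : ℝ) :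
    Tendsto (fun u : ℝ ↦ Real.exp (-(2 * η * u)) * k u / D) atTop (𝓝 0) := by
  have h1 : Tendsto (fun u : ℝ ↦ Real.exp (-(2 * η * u))) atTop (𝓝 0) :=
    Real.tendsto_exp_neg_atTop_nhds_zero.comp (tendsto_id.const_mul_atTop (by positivity))
  have h2 : Tendsto (fun u : ℝ ↦ Real.exp (-(2 * η * u)) * (B / |D|)) atTop (𝓝 0) := by
    simpa using h1.mul_const (B / |D|)
  refine squeeze_zero_norm (fun u ↦ ?_) h2
  rw [Real.norm_eq_abs, abs_div, abs_mul, abs_of_pos (Real.exp_pos _), mul_div_assoc]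
  exact mul_le_mul_of_nonneg_left (div_le_div_of_nonneg_right (hk u) (abs_nonneg D))
    (Real.exp_pos _).le

/-! ## Closed forms -/

/-- **Closed form** `∫₀^∞ e^{-2ηu} cos(ω(u-a)) du = (2η cos(ωa) + ω sin(ωa))/(4η² + ω²)` (`η > 0`).
[folklore] -/
theorem torusSep_integral_exp_cos {η : ℝ} (hη : 0 < η) (ω a : ℝ) :
    ∫ u in Ioi (0 : ℝ), Real.exp (-(2 * η * u)) * Real.cos (ω * (u - a)) =
      (2 * η * Real.cos (ω * a) + ω * Real.sin (ω * a)) / (4 * η ^ 2 + ω ^ 2) := by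
  have hD : 4 * η ^ 2 + ω ^ 2 ≠ 0 := by positivity
  have hlim : Tendsto (fun x : ℝ ↦ Real.exp (-(2 * η * x)) *
      (-(2 * η) * Real.cos (ω * (x - a)) + ω * Real.sin (ω * (x - a))) / (4 * η ^ 2 + ω ^ 2))
      atTop (𝓝 0) := by
    refine torusSep_tendsto_exp_mul_zero hη (B := 2 * |η| + |ω|) (fun u ↦ ?_) _
    calc |-(2 * η) * Real.cos (ω * (u - a)) + ω * Real.sin (ω * (u - a))|
        ≤ |-(2 * η) * Real.cos (ω * (u - a))| + |ω * Real.sin (ω * (u - a))| := abs_add_le _ _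
      _ ≤ 2 * |η| + |ω| := by
          rw [abs_mul, abs_mul, abs_neg, abs_mul, abs_two]
          exact add_le_add (mul_le_of_le_one_right (by positivity) (Real.abs_cos_le_one _))
            (mul_le_of_le_one_right (abs_nonneg _) (Real.abs_sin_le_one _))
  rw [integral_Ioi_of_hasDerivAt_of_tendsto (by fun_prop)
    (fun u _ ↦ torusSep_hasDerivAt_cos hD a u) (torusSep_integrableOn_exp_cos hη ω a 0) hlim]
  simp only [mul_zero, neg_zero, Real.exp_zero, one_mul, zero_sub, mul_neg, Real.cos_neg,
    Real.sin_neg]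
  field_simp
  ring

/-- **Closed form** `∫₀^∞ e^{-2ηu} sin(ω(u-a)) du = (ω cos(ωa) - 2η sin(ωa))/(4η² + ω²)` (`η > 0`).
[folklore] -/
theorem torusSep_integral_exp_sin {η : ℝ} (hη : 0 < η) (ω a : ℝ) :
    ∫ u in Ioi (0 : ℝ), Real.exp (-(2 * η * u)) * Real.sin (ω * (u - a)) =
      (ω * Real.cos (ω * a) - 2 * η * Real.sin (ω * a)) / (4 * η ^ 2 + ω ^ 2) := by
  have hD : 4 * η ^ 2 + ω ^ 2 ≠ 0 := by positivity
  have hlim : Tendsto (fun x : ℝ ↦ Real.exp (-(2 * η * x)) *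
      (-(2 * η) * Real.sin (ω * (x - a)) - ω * Real.cos (ω * (x - a))) / (4 * η ^ 2 + ω ^ 2))
      atTop (𝓝 0) := by
    refine torusSep_tendsto_exp_mul_zero hη (B := 2 * |η| + |ω|) (fun u ↦ ?_) _
    calc |-(2 * η) * Real.sin (ω * (u - a)) - ω * Real.cos (ω * (u - a))|
        ≤ |-(2 * η) * Real.sin (ω * (u - a))| + |ω * Real.cos (ω * (u - a))| := abs_sub _ _
      _ ≤ 2 * |η| + |ω| := by
          rw [abs_mul, abs_mul, abs_neg, abs_mul, abs_two]
          exact add_le_add (mul_le_of_le_one_right (by positivity) (Real.abs_sin_le_one _))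
            (mul_le_of_le_one_right (abs_nonneg _) (Real.abs_cos_le_one _))
  rw [integral_Ioi_of_hasDerivAt_of_tendsto (by fun_prop)
    (fun u _ ↦ torusSep_hasDerivAt_sin hD a u) (torusSep_integrableOn_exp_sin hη ω a 0) hlim]
  simp only [mul_zero, neg_zero, Real.exp_zero, one_mul, zero_sub, mul_neg, Real.cos_neg,
    Real.sin_neg]
  field_simp
  ring

/-- **Window decomposition**: `∫₀^a e^{-2ηu} cos(ω(u-a)) du = h_a(ω) - 2η e^{-2ηa}/(4η²+ω²)`, i.e.
`h_a(ω) = ∫₀^a e^{-2ηu} cos(ω(a-u)) du + 2η e^{-2ηa}/(4η²+ω²)`. [folklore] -/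
theorem torusSep_intervalIntegral_exp_cos {η : ℝ} (hη : 0 < η) (ω a : ℝ) :
    ∫ u in (0 : ℝ)..a, Real.exp (-(2 * η * u)) * Real.cos (ω * (u - a)) =
      (2 * η * Real.cos (ω * a) + ω * Real.sin (ω * a)) / (4 * η ^ 2 + ω ^ 2) -
        2 * η * Real.exp (-(2 * η * a)) / (4 * η ^ 2 + ω ^ 2) := by
  have hD : 4 * η ^ 2 + ω ^ 2 ≠ 0 := by positivity
  rw [integral_eq_sub_of_hasDerivAt (fun u _ ↦ torusSep_hasDerivAt_cos hD a u)
    ((by fun_prop : Continuous fun u : ℝ ↦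
      Real.exp (-(2 * η * u)) * Real.cos (ω * (u - a))).intervalIntegrable _ _)]
  simp only [sub_self, mul_zero, Real.cos_zero, Real.sin_zero, mul_one, add_zero, neg_zero,
    Real.exp_zero, one_mul, zero_sub, mul_neg, Real.cos_neg, Real.sin_neg]
  field_simp
  ring

/-! ## Size bounds -/

/-- `h² + q² = 1/(4η² + ω²)` for the two closed forms. [folklore] -/
theorem torusSep_closedForm_sq_add_sq {η : ℝ} (hη : 0 < η) (ω a : ℝ) :
    ((2 * η * Real.cos (ω * a) + ω * Real.sin (ω * a)) / (4 * η ^ 2 + ω ^ 2)) ^ 2 +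
        ((ω * Real.cos (ω * a) - 2 * η * Real.sin (ω * a)) / (4 * η ^ 2 + ω ^ 2)) ^ 2 =
      1 / (4 * η ^ 2 + ω ^ 2) := by
  have hD : 4 * η ^ 2 + ω ^ 2 ≠ 0 := by positivity
  have hcs := Real.cos_sq_add_sin_sq (ω * a)
  field_simp
  linear_combination (4 * η ^ 2 + ω ^ 2) * hcs

/-- `|h_a(ω)| ≤ 1/|ω|` for `ω ≠ 0`. [folklore] -/
theorem torusSep_abs_closedForm_cos_le {η : ℝ} (hη : 0 < η) {ω : ℝ} (hω : ω ≠ 0) (a : ℝ) :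
    |(2 * η * Real.cos (ω * a) + ω * Real.sin (ω * a)) / (4 * η ^ 2 + ω ^ 2)| ≤ 1 / |ω| := by
  have h := torusSep_closedForm_sq_add_sq hη ω a
  have hω2 : 0 < ω ^ 2 := by positivity
  have h1 : ((2 * η * Real.cos (ω * a) + ω * Real.sin (ω * a)) / (4 * η ^ 2 + ω ^ 2)) ^ 2 ≤
      (1 / |ω|) ^ 2 := by
    have e : (1 / |ω|) ^ 2 = 1 / ω ^ 2 := by rw [div_pow, one_pow, sq_abs]
    rw [e]
    calc _ ≤ 1 / (4 * η ^ 2 + ω ^ 2) := by nlinarith [h]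
      _ ≤ 1 / ω ^ 2 := div_le_div_of_nonneg_left zero_le_one hω2 (by nlinarith)
  exact abs_le_of_sq_le_sq h1 (by positivity)

/-- `|q_a(ω)| ≤ 1/|ω|` for `ω ≠ 0`. [folklore] -/
theorem torusSep_abs_closedForm_sin_le {η : ℝ} (hη : 0 < η) {ω : ℝ} (hω : ω ≠ 0) (a : ℝ) :
    |(ω * Real.cos (ω * a) - 2 * η * Real.sin (ω * a)) / (4 * η ^ 2 + ω ^ 2)| ≤ 1 / |ω| := by
  have h := torusSep_closedForm_sq_add_sq hη ω a
  have hω2 : 0 < ω ^ 2 := by positivity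
  have h1 : ((ω * Real.cos (ω * a) - 2 * η * Real.sin (ω * a)) / (4 * η ^ 2 + ω ^ 2)) ^ 2 ≤
      (1 / |ω|) ^ 2 := by
    have e : (1 / |ω|) ^ 2 = 1 / ω ^ 2 := by rw [div_pow, one_pow, sq_abs]
    rw [e]
    calc _ ≤ 1 / (4 * η ^ 2 + ω ^ 2) := by nlinarith [h]
      _ ≤ 1 / ω ^ 2 := div_le_div_of_nonneg_left zero_le_one hω2 (by nlinarith)
  exact abs_le_of_sq_le_sq h1 (by positivity)

/-! ## Sign structure in the quarter window -/

/-- **Lower bound in the window.** For `a ≥ 0`, `ω ≥ 0`, `ωa ≤ π/2`: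
`h_a(ω) ≥ (2a/π) ω²/(4η²+ω²)` (drop `2η cos(ωa) ≥ 0`, then Jordan `sin x ≥ (2/π) x`). [folklore] -/
theorem torusSep_closedForm_cos_ge {η : ℝ} (hη : 0 < η) {ω a : ℝ} (ha : 0 ≤ a) (hω : 0 ≤ ω)
    (hωa : ω * a ≤ Real.pi / 2) :
    2 * a / Real.pi * ω ^ 2 / (4 * η ^ 2 + ω ^ 2) ≤
      (2 * η * Real.cos (ω * a) + ω * Real.sin (ω * a)) / (4 * η ^ 2 + ω ^ 2) := by
  have hD : 0 < 4 * η ^ 2 + ω ^ 2 := by positivity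
  have hωa0 : 0 ≤ ω * a := mul_nonneg hω ha
  have hcos : 0 ≤ Real.cos (ω * a) :=
    Real.cos_nonneg_of_neg_pi_div_two_le_of_le (by linarith [Real.pi_pos]) hωa
  have hsin : 2 / Real.pi * (ω * a) ≤ Real.sin (ω * a) := Real.mul_le_sin hωa0 hωa
  rw [div_le_div_iff_of_pos_right hD]
  have h1 : 2 * a / Real.pi * ω ^ 2 = ω * (2 / Real.pi * (ω * a)) := by ring
  rw [h1]
  nlinarith [mul_le_mul_of_nonneg_left hsin hω, mul_nonneg (by positivity : (0 : ℝ) ≤ 2 * η) hcos]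

/-- **Non-negativity in the window**: `h_a(ω) ≥ 0` for `a ≥ 0`, `ω ≥ 0`, `ωa ≤ π/2`. [folklore] -/
theorem torusSep_closedForm_cos_nonneg {η : ℝ} (hη : 0 < η) {ω a : ℝ} (ha : 0 ≤ a) (hω : 0 ≤ ω)
    (hωa : ω * a ≤ Real.pi / 2) :
    0 ≤ (2 * η * Real.cos (ω * a) + ω * Real.sin (ω * a)) / (4 * η ^ 2 + ω ^ 2) :=
  le_trans (by positivity) (torusSep_closedForm_cos_ge hη ha hω hωa)

/-- **Monotonicity in the window**: for `a ≥ 0` and `0 ≤ ω₁ ≤ ω₂` with `ω₂ a ≤ π/2`,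
`h_a(ω₂) ≤ h_a(ω₁)`.  Proof: by the window decomposition, `h_a(ω) = ∫₀^a e^{-2ηu} cos(ω(a-u)) du +
2η e^{-2ηa}/(4η²+ω²)`; the integrand is pointwise non-increasing in `ω` (`0 ≤ ω(a-u) ≤ π/2` and
`cos` decreases on `[0, π]`), and so is `2η/(4η²+ω²)`. [folklore] -/
theorem torusSep_closedForm_cos_antitone {η : ℝ} (hη : 0 < η) {ω₁ ω₂ a : ℝ} (ha : 0 ≤ a)
    (hω₁ : 0 ≤ ω₁) (h12 : ω₁ ≤ ω₂) (hωa : ω₂ * a ≤ Real.pi / 2) :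
    (2 * η * Real.cos (ω₂ * a) + ω₂ * Real.sin (ω₂ * a)) / (4 * η ^ 2 + ω₂ ^ 2) ≤
      (2 * η * Real.cos (ω₁ * a) + ω₁ * Real.sin (ω₁ * a)) / (4 * η ^ 2 + ω₁ ^ 2) := by
  have e1 := torusSep_intervalIntegral_exp_cos hη ω₁ a
  have e2 := torusSep_intervalIntegral_exp_cos hη ω₂ a
  -- the interval integrals compare pointwise
  have hint : ∫ u in (0 : ℝ)..a, Real.exp (-(2 * η * u)) * Real.cos (ω₂ * (u - a)) ≤
      ∫ u in (0 : ℝ)..a, Real.exp (-(2 * η * u)) * Real.cos (ω₁ * (u - a)) := by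
    refine integral_mono_on ha ((by fun_prop : Continuous fun u : ℝ ↦
        Real.exp (-(2 * η * u)) * Real.cos (ω₂ * (u - a))).intervalIntegrable _ _)
      ((by fun_prop : Continuous fun u : ℝ ↦
        Real.exp (-(2 * η * u)) * Real.cos (ω₁ * (u - a))).intervalIntegrable _ _)
      fun u hu ↦ ?_
    refine mul_le_mul_of_nonneg_left ?_ (Real.exp_pos _).le
    rw [show ω₂ * (u - a) = -(ω₂ * (a - u)) by ring, show ω₁ * (u - a) = -(ω₁ * (a - u)) by ring,
      Real.cos_neg, Real.cos_neg]
    have hau : 0 ≤ a - u := by linarith [hu.2]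
    have hau' : a - u ≤ a := by linarith [hu.1]
    refine Real.cos_le_cos_of_nonneg_of_le_pi (mul_nonneg hω₁ hau) ?_
      (mul_le_mul_of_nonneg_right h12 hau)
    calc ω₂ * (a - u) ≤ ω₂ * a := mul_le_mul_of_nonneg_left hau' (hω₁.trans h12)
      _ ≤ Real.pi / 2 := hωa
      _ ≤ Real.pi := by linarith [Real.pi_pos]
  -- the tails compare
  have htail : 2 * η * Real.exp (-(2 * η * a)) / (4 * η ^ 2 + ω₂ ^ 2) ≤
      2 * η * Real.exp (-(2 * η * a)) / (4 * η ^ 2 + ω₁ ^ 2) :=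
    div_le_div_of_nonneg_left (by positivity) (by positivity) (by nlinarith)
  linarith

/-! ## Summary statement (the registered sub-goal of this helper file) -/

/-- **Half-line Gram integrals** (summary of this file, `η > 0`): the closed forms of
`∫₀^∞ e^{-2ηu} cos(ω(u-a)) du` and `∫₀^∞ e^{-2ηu} sin(ω(u-a)) du`, the identity `h² + q² = 1/(4η²+ω²)`,
and the quarter-window sign structure of `h_a` (lower bound `(2a/π)ω²/(4η²+ω²)` and monotonicity
for `0 ≤ ω₁ ≤ ω₂`, `ω₂a ≤ π/2`, `a ≥ 0`). [folklore] -/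
theorem torusSep_gramIntegrals :
    ∀ η : ℝ, 0 < η → ∀ a : ℝ,
      (∀ ω : ℝ, ∫ u in Set.Ioi (0 : ℝ), Real.exp (-(2 * η * u)) * Real.cos (ω * (u - a)) =
        (2 * η * Real.cos (ω * a) + ω * Real.sin (ω * a)) / (4 * η ^ 2 + ω ^ 2)) ∧
      (∀ ω : ℝ, ∫ u in Set.Ioi (0 : ℝ), Real.exp (-(2 * η * u)) * Real.sin (ω * (u - a)) =
        (ω * Real.cos (ω * a) - 2 * η * Real.sin (ω * a)) / (4 * η ^ 2 + ω ^ 2)) ∧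
      (∀ ω : ℝ, ((2 * η * Real.cos (ω * a) + ω * Real.sin (ω * a)) / (4 * η ^ 2 + ω ^ 2)) ^ 2 +
        ((ω * Real.cos (ω * a) - 2 * η * Real.sin (ω * a)) / (4 * η ^ 2 + ω ^ 2)) ^ 2 =
          1 / (4 * η ^ 2 + ω ^ 2)) ∧
      (0 ≤ a → ∀ ω : ℝ, 0 ≤ ω → ω * a ≤ Real.pi / 2 →
        2 * a / Real.pi * ω ^ 2 / (4 * η ^ 2 + ω ^ 2) ≤
          (2 * η * Real.cos (ω * a) + ω * Real.sin (ω * a)) / (4 * η ^ 2 + ω ^ 2)) ∧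
      (0 ≤ a → ∀ ω₁ ω₂ : ℝ, 0 ≤ ω₁ → ω₁ ≤ ω₂ → ω₂ * a ≤ Real.pi / 2 →
        (2 * η * Real.cos (ω₂ * a) + ω₂ * Real.sin (ω₂ * a)) / (4 * η ^ 2 + ω₂ ^ 2) ≤
          (2 * η * Real.cos (ω₁ * a) + ω₁ * Real.sin (ω₁ * a)) / (4 * η ^ 2 + ω₁ ^ 2)) :=
  fun _ hη a ↦ ⟨fun ω ↦ torusSep_integral_exp_cos hη ω a, fun ω ↦ torusSep_integral_exp_sin hη ω a,
    fun ω ↦ torusSep_closedForm_sq_add_sq hη ω a,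
    fun ha _ hω hωa ↦ torusSep_closedForm_cos_ge hη ha hω hωa,
    fun ha _ _ hω₁ h12 hωa ↦ torusSep_closedForm_cos_antitone hη ha hω₁ h12 hωa⟩

end Summit.RiemannHypothesis.RiemannHypothesis.Theorems.WeilParityOffLineParityDetection

end
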